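import Literature.MathematicalPhysics.QuantumFieldTheory.Balaban1983to89.Node00.Record5
import Literature.MathematicalPhysics.QuantumFieldTheory.Balaban1983to89.T4Spectator

/-!
# `Balaban1983to89.B14NodeKnitRepTower` — YM-DAG node N11 · [Balaban1988Convergent] CMP **119** (1988) 243–285, Theorem 1 p. 262
# (with the Theorem of p. 245 and the ASSUMED operation 𝐑 of p. 244): the N11 knit OVER A REPRESENTED TOWER (NODE 00 Stage ₉ shape, pub-ymgap
# chair R437: the densities of record are `ρ_k := eval rep_k`, `rep_{k+1} := Rstep (Tstep rep_k)`, «ρ_k has the form (2.18)» :↔ `ρ_k = eval rep_k ∧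
# Laws rep_k`) — and the a.e. bridge between an explicit renormalisation transform and NODE 00's `TrhoOfRecord`

statement-level bookkeeping over published theorems with citation tags; kernel-checked compositions of tree theorems;
nothing here is a claim about the Yang–Mills mass gap.

CITATION HEADER (lean-in-tree rule).  Source: T. Bałaban, *Convergent renormalization expansions for lattice gauge theories*,
Commun. Math. Phys. **119**, 243–285 (1988), doi:10.1007/bf01217741 [Balaban1988Convergent] (cell paper B14 = «[III]»); the renormalisation
transformation `(Tρ)(V) = ∫ dU δ(Ū V⁻¹) ρ(U)` is [Balaban1985Averaging] (10) p. 19 ∕ [III] (0.1) p. 244, read by the tree as the push-forward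
identity `Setup.IsRT` (cell DIVERGENCE F7).  Seat `pub-ymgap-dag-n11-a` (YM-PLAN Track A, HUMAN RULING D-0062: the KNIT-BY-NAME seat of node N11;
R420 ∕ R422 ∕ R424 ∕ R434 ∕ R437).  BY NAME and UNCHANGED: `…Node00.Record5` (seat pub-ymgap-node00-def: `Stage5Params`, `densOfRecord₅`,
`machineOfRecord₅`, `dens_machineOfRecord₅`), `…Node00.DatumAvLayer` (`avOfRecord`, `avOfRecord_measurable`, `avOfRecord_haarAC`, `TrhoOfRecord`,
`isRT_TrhoOfRecord`, `integrable_TrhoOfRecord`), `…T4DatumAssembly` (`RGMachine.integrable_dens`), `…T4Spectator` (cell pub-balaban: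
`ae_eq_of_isRT_of_isRT`), `…Setup` (`IsRT`, `fieldMeasure`), `…Dag` (`B14_main` :224), `…DagBinding` (`leavesP`, `WorldP`).

WHY THIS FILE (pub-ymgap chair R437, 2026-08-25, adopting seat node00-def's `STAGE6-9-DESIGN-g28.md` §2 and seat dag-n13-b's kernel certificate
`probe_Stage7_pointwise`).  Over NODE 00's Stages ₅C∕₇C∕₈C the record's tower steps through `TrhoOfRecord = AveragingRT.rnTransport`, a VERSION
of a Radon–Nikodym derivative, about which only a.e. facts exist; the design of record (R2) therefore RE-BASES the record at Stage ₉ on the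
REPRESENTED TOWER print actually manipulates ([III] (2.18) «ρ_k can be represented as Σ … χ_k(Ω_k) 𝐓_k(…) exp A_k»; [Balaban1989LargeFieldI]
(0.2)): per run, representation data `rep_k` with `ρ_k := eval rep_k` (explicit, pointwise meaningful), the two steps `Tstep` ([III] §3 — the
content of the Theorem of p. 245) and `Rstep` ([IV] (0.3)∕(1.100)) acting ON representations, `rep_{k+1} := Rstep (Tstep rep_k)`, and the §2-form
clause `Sect2Form k :↔ ρ_k = eval rep_k ∧ Laws rep_k` — a property of the CARRIED object.  N11 ([III] Thm 1: «the densities ρ_k … have the form,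
and satisfy all the conditions and bounds, described in Sect. 2») then reads: the LAWS are preserved along the tower — (S0) `Laws rep₀`; (S1)
`Laws rep_k → LawsT (Tstep rep_k)` (the Theorem of p. 245 at representation level: T carries the index-`k` space into the corresponding space,
p. 262); (𝐑) `LawsT r → Laws (Rstep r)` (the assumed property of 𝐑, p. 244).  §1 is that knit, GENERIC over the representation types and the
two law families (so that NODE 00's `datumOfRepTower` instantiates it by `rfl` whatever its final field names), T NOT hard-wired (R437 (1):
«glue BY NAME over the record's ρ_k»).  §2 records the a.e. bridge R437 keeps as a displayed theorem-to-prove: once `IsRT avg (eval rep_k)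
(eval (Tstep rep_k))` is proved, the explicit T-image agrees a.e. with NODE 00's `TrhoOfRecord (eval rep_k)` (`ae_eq_TrhoOfRecord_of_isRT`) — the
link between the Stage-₉ and Stage-₅C record bases — together with the integrability of the Stage-5 tower and the corresponding a.e.-saturated
format lemma (`scorr_TrhoOfRecord_of_isRT_witness`: for a format that does not separate a.e.-equal densities, ANY integrable `IsRT`-image in it
puts `TrhoOfRecord ρ` in it).

WHAT THIS FILE PROVES (0 `sorry`, 0 `def`, standard axioms).
§1 `b14_main_of_propTower` (N11 at `(w, P)` from two ℕ-indexed predicates «in the index-`k` space» ∕ «in the corresponding space» read into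
   `(w.C P).Sect2Form`, by the induction of Thm 1 p. 262); **`b14_main_of_repTower`** (N11 over a represented tower `rep`, `Tstep`, `Rstep`,
   `rep (k+1) = Rstep k (Tstep k (rep k))`, law families `Laws`, `LawsT`); `sect2Form_iff_laws_of_eval` ∕ `densitiesDescribed_iff_laws` (under the
   Stage-₉ reading `Sect2Form k ↔ (ρ_k = eval rep_k ∧ Laws rep_k)` with `ρ_k = eval rep_k`: the node's conclusion IS `∀ k ≤ K, Laws (rep k)`);
   **`b14_main_of_repTower_eval`** (the knit under that reading: slots (S0), (S1), (𝐑) only).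
§2 `integrable_densOfRecord₅`, `isRT_TrhoOfRecord_densOfRecord₅` (Stage-5 tower: integrable, and `Tρ_k` of record IS an `IsRT`-image, `k < K`);
   `ae_eq_TrhoOfRecord_of_isRT` (an integrable `IsRT`-image of an integrable `ρ` agrees a.e. with `TrhoOfRecord ρ`); `scorr_TrhoOfRecord_of_isRT_witness`.

HONEST FRAMING.  A count-neutral SLOT landing (R429 (4)(i)): N11 is NOT discharged; (S1) = Sects. 1–3 + Thm 2 of [Balaban1988Convergent] at
representation level is a displayed hypothesis (its objects — `Tstep`, `Laws` — are NODE 00 Stage ₉'s, not yet in the tree; §1 is generic over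
them); (𝐑) is the printed ASSUMPTION of p. 244 (discharged by [Balaban1989LargeFieldII], node N13).  One finite four-torus programme at fixed `ε`,
Bałaban AS PRINTED with locators; nothing continuum ∕ ℝ⁴ ∕ OS ∕ mass gap ∕ Clay.
-/

noncomputable section

open MeasureTheory

namespace Literature.MathematicalPhysics.QuantumFieldTheory.Balaban1983to89.B14NodeKnitRepTower

open DagBinding T4DatumAssembly T4Continuum Node00
open T4Spectator (ae_eq_of_isRT_of_isRT)

/-! ## §1. N11 over a represented tower (NODE 00 Stage ₉ shape; T not hard-wired) -/

section PropTower

variable (w : WorldP) (P : B12.RunParams)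

/-- **N11 from two ℕ-indexed space predicates** ([Balaban1988Convergent] Thm 1 p. 262, the induction verbatim: *«the sequence of densities ρ_k
… defined by (0.2) … have the form … described in Sect. 2»*): `InS k` «the `k`-th object lies in the index-`k` space» and `InT k` «its
renormalisation transform lies in the corresponding space», READ into the run's §2-form clause (`hS`); slots (S0) start, (S1) T-step (the
Theorem of p. 245) GIVEN the node's antecedents, (𝐑) the assumed property of 𝐑 (p. 244) GIVEN the `rOperation` leaf.  Pure logic over
`Dag.B14_main`'s shape; no carrier fixed. [cite: Balaban1988Convergent, Thm 1 p.262; Theorem p.245; p.244] -/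
theorem b14_main_of_propTower (InS InT : ℕ → Prop) (hS : ∀ k, k ≤ P.K → InS k → (w.C P).Sect2Form k)
    (h0 : (leavesP w P).smallCouplings → InS 0)
    (hT : (leavesP w P).b7 → (leavesP w P).b8 → (leavesP w P).b9 → (leavesP w P).b10 → (leavesP w P).b11 →
      (leavesP w P).smallCouplings → (leavesP w P).smallFieldInductive → (leavesP w P).flowControl →
        ∀ k, k < P.K → InS k → InT k)
    (hR : (leavesP w P).rOperation → ∀ k, k < P.K → InT k → InS (k + 1)) :
    Dag.B14_main (leavesP w P) := by
  intro h7 h8 h9 h10 h11 hsf hfc hrop hsc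
  have hind : ∀ k, k ≤ P.K → InS k := by
    intro k
    induction k with
    | zero => exact fun _ => h0 hsc
    | succ n ih =>
      intro hk
      exact hR hrop n (Nat.lt_of_succ_le hk)
        (hT h7 h8 h9 h10 h11 hsc (hsf hsc) (hfc hsc) n (Nat.lt_of_succ_le hk) (ih (Nat.le_of_succ_le hk)))
  exact fun k hk => hS k hk (hind k hk)

end PropTower

section RepTower

variable (w : WorldP) (P : B12.RunParams) {Rep : ℕ → Type*} (rep : (k : ℕ) → Rep k)
  (Tstep : (k : ℕ) → Rep k → Rep (k + 1)) (Rstep : (k : ℕ) → Rep (k + 1) → Rep (k + 1))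
  (Laws : (k : ℕ) → Rep k → Prop) (LawsT : (k : ℕ) → Rep (k + 1) → Prop)

/-- **N11 OVER A REPRESENTED TOWER** ([Balaban1988Convergent] Thm 1 p. 262 with the Theorem of p. 245 and the assumed 𝐑 of p. 244; NODE 00 Stage ₉
shape, pub-ymgap chair R437): representation data `rep k : Rep k` per level with `rep (k+1) = Rstep k (Tstep k (rep k))` (`hsucc` — [III] (0.2)
`ρ_{k+1} = 𝐑Tρ_k` at representation level), a law family `Laws k` («the representation has the form (2.18) with the conditions of Sect. 2», index
`k`) and its T-image companion `LawsT k` (the corresponding space of p. 262 ∕ p. 279, BEFORE 𝐑), the §2-form clause of the run implied by the laws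
of the carried representation (`hS`).  N11 at `(w, P)` from: (S0) `h0` the start representation obeys the laws, under the interval hypothesis;
(S1) `hT` THE THEOREM OF p. 245 AT REPRESENTATION LEVEL — GIVEN the in-edges `b7 … b11`, the interval hypothesis, the small-field inductive
assumptions and the flow control (2.6), `Tstep` carries law-abiding representations into the corresponding space, `k < K`; (𝐑) `hR` — GIVEN the
`rOperation` leaf — `Rstep` carries the corresponding space into the index-`(k+1)` laws ([III] p. 244, discharged by [Balaban1989LargeFieldII]).
T is NOT hard-wired: `Tstep` is whatever the record carries. [cite: Balaban1988Convergent, Thm 1 p.262; Theorem p.245; (0.2) and p.244] -/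
theorem b14_main_of_repTower (hsucc : ∀ k, rep (k + 1) = Rstep k (Tstep k (rep k)))
    (hS : ∀ k, k ≤ P.K → Laws k (rep k) → (w.C P).Sect2Form k)
    (h0 : (leavesP w P).smallCouplings → Laws 0 (rep 0))
    (hT : (leavesP w P).b7 → (leavesP w P).b8 → (leavesP w P).b9 → (leavesP w P).b10 → (leavesP w P).b11 →
      (leavesP w P).smallCouplings → (leavesP w P).smallFieldInductive → (leavesP w P).flowControl →
        ∀ k, k < P.K → Laws k (rep k) → LawsT k (Tstep k (rep k)))
    (hR : (leavesP w P).rOperation → ∀ k, k < P.K → ∀ r : Rep (k + 1), LawsT k r → Laws (k + 1) (Rstep k r)) :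
    Dag.B14_main (leavesP w P) :=
  b14_main_of_propTower w P (fun k => Laws k (rep k)) (fun k => LawsT k (Tstep k (rep k))) hS h0 hT
    fun hrop k hk h => by rw [hsucc]; exact hR hrop k hk _ h

/-- The same with (𝐑) asked only ALONG THE TOWER (`LawsT k (Tstep k (rep k)) → Laws (k+1) (rep (k+1))`; no `Rstep` named) — the weakest form the
induction uses. [cite: Balaban1988Convergent, Thm 1 p.262; Theorem p.245; p.244] -/
theorem b14_main_of_repTower_along
    (hS : ∀ k, k ≤ P.K → Laws k (rep k) → (w.C P).Sect2Form k)
    (h0 : (leavesP w P).smallCouplings → Laws 0 (rep 0))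
    (hT : (leavesP w P).b7 → (leavesP w P).b8 → (leavesP w P).b9 → (leavesP w P).b10 → (leavesP w P).b11 →
      (leavesP w P).smallCouplings → (leavesP w P).smallFieldInductive → (leavesP w P).flowControl →
        ∀ k, k < P.K → Laws k (rep k) → LawsT k (Tstep k (rep k)))
    (hR : (leavesP w P).rOperation → ∀ k, k < P.K → LawsT k (Tstep k (rep k)) → Laws (k + 1) (rep (k + 1))) :
    Dag.B14_main (leavesP w P) :=
  b14_main_of_propTower w P (fun k => Laws k (rep k)) (fun k => LawsT k (Tstep k (rep k))) hS h0 hT hR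

variable (eval : (k : ℕ) → Rep k → ((w.C P).Cfg k → ℝ))

/-- **Under the Stage-₉ reading of the §2-form clause** — `Sect2Form k ↔ (ρ_k = eval rep_k ∧ Laws rep_k)` (`hS9`, NODE 00's `S218 p k ρ :↔ ρ =
eval rep_k ∧ Laws rep_k` read at `ρ_k`) with the densities of record DEFINED as `ρ_k = eval rep_k` (`hρ`) — the clause IS the law of the carried
representation. [cite: Balaban1988Convergent, (2.18) p.257 and Thm 1 p.262 (bookkeeping)] -/
theorem sect2Form_iff_laws_of_eval (hρ : ∀ k, (w.C P).ρ k = eval k (rep k))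
    (hS9 : ∀ k, k ≤ P.K → ((w.C P).Sect2Form k ↔ ((w.C P).ρ k = eval k (rep k) ∧ Laws k (rep k)))) (k : ℕ) (hk : k ≤ P.K) :
    (w.C P).Sect2Form k ↔ Laws k (rep k) := by
  rw [hS9 k hk]
  exact ⟨fun h => h.2, fun h => ⟨hρ k, h⟩⟩

/-- … so N11's CONCLUSION `densitiesDescribed` at such a run IS «every carried representation obeys the laws», `∀ k ≤ K, Laws k (rep k)` — no
longer closable by a trivially true format (the vacuity audit A4 for N11 at Stage ₉, kernel form). [cite: Balaban1988Convergent, Thm 1 p.262 (bookkeeping)] -/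
theorem densitiesDescribed_iff_laws (hρ : ∀ k, (w.C P).ρ k = eval k (rep k))
    (hS9 : ∀ k, k ≤ P.K → ((w.C P).Sect2Form k ↔ ((w.C P).ρ k = eval k (rep k) ∧ Laws k (rep k)))) :
    (leavesP w P).densitiesDescribed ↔ ∀ k, k ≤ P.K → Laws k (rep k) := by
  show (∀ k, k ≤ P.K → (w.C P).Sect2Form k) ↔ _
  exact forall₂_congr fun k hk => sect2Form_iff_laws_of_eval w P rep Laws eval hρ hS9 k hk

/-- **N11 OVER A REPRESENTED TOWER UNDER THE STAGE-₉ READING** (`ρ_k = eval rep_k`, `Sect2Form k ↔ ρ_k = eval rep_k ∧ Laws rep_k`): `Dag.B14_main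
(leavesP w P)` from EXACTLY the three printed slots (S0), (S1), (𝐑) of `b14_main_of_repTower` — no pin remains on the §2-form side.  The shape
NODE 00's `datumOfRepTower` instantiates (`hρ`, `hS9`, `hsucc` by `rfl`∕`Iff.rfl`). [cite: Balaban1988Convergent, Thm 1 p.262; Theorem p.245; (0.2) and p.244] -/
theorem b14_main_of_repTower_eval (hsucc : ∀ k, rep (k + 1) = Rstep k (Tstep k (rep k)))
    (hρ : ∀ k, (w.C P).ρ k = eval k (rep k))
    (hS9 : ∀ k, k ≤ P.K → ((w.C P).Sect2Form k ↔ ((w.C P).ρ k = eval k (rep k) ∧ Laws k (rep k))))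
    (h0 : (leavesP w P).smallCouplings → Laws 0 (rep 0))
    (hT : (leavesP w P).b7 → (leavesP w P).b8 → (leavesP w P).b9 → (leavesP w P).b10 → (leavesP w P).b11 →
      (leavesP w P).smallCouplings → (leavesP w P).smallFieldInductive → (leavesP w P).flowControl →
        ∀ k, k < P.K → Laws k (rep k) → LawsT k (Tstep k (rep k)))
    (hR : (leavesP w P).rOperation → ∀ k, k < P.K → ∀ r : Rep (k + 1), LawsT k r → Laws (k + 1) (Rstep k r)) :
    Dag.B14_main (leavesP w P) :=
  b14_main_of_repTower w P rep Tstep Rstep Laws LawsT hsucc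
    (fun k hk h => (sect2Form_iff_laws_of_eval w P rep Laws eval hρ hS9 k hk).2 h) h0 hT hR

/-- Conversely, under the Stage-₉ reading N11 at `(w, P)` YIELDS the laws along the tower whenever its antecedents hold: the node's content is
exactly law-preservation (located, for the planner's `stub_N11` text over Stage ₉). [cite: Balaban1988Convergent, Thm 1 p.262 (bookkeeping)] -/
theorem laws_of_b14_main_eval (hρ : ∀ k, (w.C P).ρ k = eval k (rep k))
    (hS9 : ∀ k, k ≤ P.K → ((w.C P).Sect2Form k ↔ ((w.C P).ρ k = eval k (rep k) ∧ Laws k (rep k))))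
    (h : Dag.B14_main (leavesP w P))
    (h7 : (leavesP w P).b7) (h8 : (leavesP w P).b8) (h9 : (leavesP w P).b9) (h10 : (leavesP w P).b10) (h11 : (leavesP w P).b11)
    (hsf : (leavesP w P).smallCouplings → (leavesP w P).smallFieldInductive)
    (hfc : (leavesP w P).smallCouplings → (leavesP w P).flowControl)
    (hrop : (leavesP w P).rOperation) (hsc : (leavesP w P).smallCouplings) :
    ∀ k, k ≤ P.K → Laws k (rep k) :=
  (densitiesDescribed_iff_laws w P rep Laws eval hρ hS9).1 (h h7 h8 h9 h10 h11 hsf hfc hrop hsc)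

end RepTower

/-! ## §2. The a.e. bridge to NODE 00's `TrhoOfRecord` (Stage-5 tower integrability; `IsRT`-images agree a.e.) -/

section AEBridge

variable (F : T4Family) (N : ℕ) [NeZero N]

/-- Every density of the Stage-5 record's tower up to the top level is integrable: `ρ_k = densOfRecord₅ θ P k`, `k ≤ P.K` (the assembler's
`RGMachine.integrable_dens` at the machine of the record and the averaging of record, through `dens_machineOfRecord₅`).
[cite: Balaban1988Convergent, (0.2) p.244 (kernel property of the tower, bookkeeping)] -/
theorem integrable_densOfRecord₅ (θ : Stage5Params F N) (P : B12.RunParams) (k : ℕ) (hk : k ≤ P.K) :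
    Integrable (densOfRecord₅ F N θ P k) (fieldMeasure (F.P P.K) k (SU N)) := by
  rw [← dens_machineOfRecord₅]
  exact (machineOfRecord₅ F N θ).integrable_dens (avOfRecord F N) (avOfRecord_measurable F N) (avOfRecord_haarAC F N) P k hk

/-- `Tρ_k` of the Stage-5 record IS a renormalisation transform of `ρ_k` in the tree's push-forward sense `IsRT`, `k < K` (`isRT_TrhoOfRecord` at the
integrable density of record). [cite: Balaban1985Averaging, (10) p.19; Balaban1988Convergent, (0.1)–(0.2) p.244] -/
theorem isRT_TrhoOfRecord_densOfRecord₅ (θ : Stage5Params F N) (P : B12.RunParams) (k : ℕ) (hk : k < P.K) :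
    IsRT (avOfRecord F N P.K k).avg (densOfRecord₅ F N θ P k) (TrhoOfRecord F N P.K k (densOfRecord₅ F N θ P k)) :=
  isRT_TrhoOfRecord F N P.K k hk _ (integrable_densOfRecord₅ F N θ P k hk.le)

variable {F N}

/-- **An explicit renormalisation transform agrees a.e. with NODE 00's `TrhoOfRecord`.**  If `ρ'` is an integrable `IsRT`-image of an integrable
step-`k` density `ρ` along the averaging of record, `k < K` — e.g. Stage ₉'s `eval (Tstep rep_k)` once its `IsRT` theorem is proved, or [III]'s
explicit fibre integral (0.1) — then `ρ' =ᵐ TrhoOfRecord F N K k ρ`: both are integrable `IsRT`-images of `ρ` (`T4Spectator.ae_eq_of_isRT_of_isRT`).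
The link between the Stage-₉ and Stage-₅C record bases (R437 (1): `₉C` re-bases `₅C`). [cite: Balaban1988Convergent, (0.1) p.244; Balaban1985Averaging, (10) p.19] -/
theorem ae_eq_TrhoOfRecord_of_isRT {K k : ℕ} (hk : k < K) (ρ : Density (F.P K) k (SU N))
    (hρ : Integrable ρ (fieldMeasure (F.P K) k (SU N))) (ρ' : Density (F.P K) (k + 1) (SU N))
    (hρ' : Integrable ρ' (fieldMeasure (F.P K) (k + 1) (SU N))) (hrt : IsRT (avOfRecord F N K k).avg ρ ρ') :
    ρ' =ᵐ[fieldMeasure (F.P K) (k + 1) (SU N)] TrhoOfRecord F N K k ρ :=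
  ae_eq_of_isRT_of_isRT hrt (isRT_TrhoOfRecord F N K k hk ρ hρ) hρ' (integrable_TrhoOfRecord F N K k hk ρ hρ)

/-- **A format that does not separate a.e.-equal densities is decided by ANY integrable `IsRT`-image.**  For a predicate `Scorr` on step-`(k+1)`
densities saturated for `fieldMeasure`-a.e. equality (`hsat`) and an integrable step-`k` density `ρ`, `k < K`: if some integrable `IsRT`-image of
`ρ` lies in `Scorr`, so does `TrhoOfRecord F N K k ρ`.  (Over a Stage-5C record this is what makes a T-step slot at `TrhoOfRecord` provable from a
theorem about an explicit T; R437 (3): an a.e. format ALONE is not the repair of record — recorded as the bridge, not as a design.)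
[cite: Balaban1988Convergent, Theorem p.245 with (0.1) p.244; Balaban1985Averaging, (10) p.19] -/
theorem scorr_TrhoOfRecord_of_isRT_witness {K k : ℕ} (hk : k < K) (Scorr : Density (F.P K) (k + 1) (SU N) → Prop)
    (hsat : ∀ ρ₁ ρ₂ : Density (F.P K) (k + 1) (SU N), ρ₁ =ᵐ[fieldMeasure (F.P K) (k + 1) (SU N)] ρ₂ → Scorr ρ₁ → Scorr ρ₂)
    (ρ : Density (F.P K) k (SU N)) (hρ : Integrable ρ (fieldMeasure (F.P K) k (SU N)))
    (hw : ∃ ρ' : Density (F.P K) (k + 1) (SU N), Integrable ρ' (fieldMeasure (F.P K) (k + 1) (SU N)) ∧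
      IsRT (avOfRecord F N K k).avg ρ ρ' ∧ Scorr ρ') :
    Scorr (TrhoOfRecord F N K k ρ) := by
  obtain ⟨ρ', hi', hrt', hS'⟩ := hw
  exact hsat ρ' _ (ae_eq_TrhoOfRecord_of_isRT hk ρ hρ ρ' hi' hrt') hS'

end AEBridge

end Literature.MathematicalPhysics.QuantumFieldTheory.Balaban1983to89.B14NodeKnitRepTower

end
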